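import Summits.Schanuel.Schanuel.Theorems.DiophantineDichotomyApproximationPropertySpaceCIMacaulay
import Summits.Schanuel.Schanuel.Theorems.DiophantineDichotomyApproximationPropertyZeroDimDictionaryZeros
import Literature.RingTheory.MvPolynomial.HomogeneousDimension
import Literature.RingTheory.KrullDimension.AffineDimension
import HarnessLib

/-!
# Stub plan `CycleAPIAt3`, Tier 0: the satellite dichotomy (P0b)

Crux `stmt-Schanuel-6117` (`Summit.Schanuel.Schanuel.Theses.DiophantineDichotomy.ApproximationProperty`),
line `orbit-interpolation-determinant`, registered stub `CycleAPIAt3 : CycleAPIAt 3`; stub plan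
`Cruxes/ApproximationProperty/STUB-PLAN-CycleAPIAt3.md`, typed helper P0b `satellite_dichotomy`
(k1 H6). Pure commutative algebra of `ℚ[x₀, …, x₃]`:

an orbit `𝔭` (homogeneous prime of rank `1`, i.e. `dim ℚ[x̲]/𝔭 = 1`) containing the three cuts
`Q, P, T` of the `t = 3` descent — `(Q)` a prime surface, `P ∉ (Q)`, so that `(Q, P)` is a
complete-intersection CURVE all of whose associated primes have `dim = 2`
(`SpaceCI.ringKrullDim_quotient_eq_two`, Macaulay) — is EITHER a minimal prime of `(Q, P, T)` (an
isolated point of the triple intersection: the good case, certified by Chardin–Philippon) OR lies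
strictly above a SATELLITE: a homogeneous prime `𝔮'` with `dim ℚ[x̲]/𝔮' = 2` which is a minimal
prime of `(Q, P)` (a component of the c.i. curve) containing `T`, `(Q, P, T) ≤ 𝔮' < 𝔭`.
Proof: a minimal prime `𝔮'` of `(Q,P,T)` below `𝔭` exists (`Ideal.exists_minimalPrimes_le`); if
`𝔮' ≠ 𝔭` then `dim/𝔮' ≥ dim/𝔭 + 1 = 2` (strict chains lengthen in the domain `ℚ[x̲]/𝔮'`,
`Literature.RingTheory.KrullDimension.ringKrullDim_quotient_add_one_le`), while a minimal prime
`𝔮₂ ≤ 𝔮'` of `(Q,P)` has `dim/𝔮₂ = 2 ≥ dim/𝔮'`; so `dim/𝔮' = 2` and `𝔮₂ = 𝔮'` by the same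
lengthening. Registered sub-goal `satellite_dichotomy` (`--supports stmt-Schanuel-6117`).

Sources: NesterenkoPhilippon2001 (LNM 1752) Ch. 10 §3 (Macaulay unmixedness); Matsumura, Thm 5.6;
folklore.
-/

noncomputable section

-- `Summit.Schanuel.Schanuel.…` is the mandated summit/sub-problem namespace (single-conjunct summit), hence:
set_option linter.dupNamespace false

attribute [local instance] MvPolynomial.gradedAlgebra

namespace Summit.Schanuel.Schanuel.Cruxes.ApproximationProperty.OrbitInterpolationDeterminant

open Literature.NumberTheory.Transcendental.Nesterenko MvPolynomial
open scoped BigOperators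

namespace SatelliteDichotomy

/-- **Strict inclusions of primes lengthen chains**: for primes `p < q` of a commutative ring,
`dim R/q + 1 ≤ dim R/p` (the image of `q` in the domain `R/p` is a non-zero prime).
[folklore] -/
theorem ringKrullDim_quotient_add_one_le_of_lt {R : Type*} [CommRing R] {p q : Ideal R}
    [p.IsPrime] (h : p < q) : ringKrullDim (R ⧸ q) + 1 ≤ ringKrullDim (R ⧸ p) := by
  haveI : IsDomain (R ⧸ p) := Ideal.Quotient.isDomain p
  have hne : q.map (Ideal.Quotient.mk p) ≠ ⊥ := by
    intro h0
    refine not_le_of_gt h fun x hx => ?_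
    have hx' : Ideal.Quotient.mk p x ∈ q.map (Ideal.Quotient.mk p) := Ideal.mem_map_of_mem _ hx
    rw [h0, Ideal.mem_bot, Ideal.Quotient.eq_zero_iff_mem] at hx'
    exact hx'
  have := Literature.RingTheory.KrullDimension.ringKrullDim_quotient_add_one_le hne
  rwa [ringKrullDim_eq_of_ringEquiv (DoubleQuot.quotQuotEquivQuotOfLE h.le)] at this


end SatelliteDichotomy

/-- **Registered sub-goal `satellite_dichotomy`** (stub plan `CycleAPIAt3`, P0b; k1 H6): an orbit
`𝔭 ⊇ (Q, P, T)` (homogeneous prime of rank `1`) on the complete-intersection curve `(Q, P)` of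
`ℚ[x₀, …, x₃]` (`(Q)` prime of degree `a ≥ 1`, `P ∉ (Q)` of degree `b ≥ 1`, `T` of degree
`τ ≥ 1`) is either a MINIMAL prime of `(Q, P, T)` or sits strictly above a SATELLITE — a
homogeneous prime `𝔮'`, unmixed of rank `2`, minimal over `(Q, P)`, with `(Q, P, T) ≤ 𝔮' < 𝔭`.
[cite: NesterenkoPhilippon2001, Ch. 10 §3 (proof of Prop. 3.6); Matsumura1987, Thm 5.6] -/
theorem satellite_dichotomy : ∀ (Q P T : Rx 3) (a b τ : ℕ), Q ≠ 0 → Q.IsHomogeneous a →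
    P.IsHomogeneous b → T.IsHomogeneous τ → 1 ≤ a → 1 ≤ b → 1 ≤ τ →
    (Ideal.span {Q}).IsPrime → P ∉ Ideal.span {Q} →
    ∀ 𝔭 : Ideal (Rx 3), 𝔭.IsPrime → 𝔭.IsHomogeneous (homogeneousSubmodule (Fin (3 + 1)) ℚ) →
    IsUnmixedOfRank 𝔭 1 → Ideal.span {Q} ⊔ Ideal.span {P} ⊔ Ideal.span {T} ≤ 𝔭 →
    𝔭 ∈ (Ideal.span {Q} ⊔ Ideal.span {P} ⊔ Ideal.span {T}).minimalPrimes ∨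
    ∃ 𝔮' : Ideal (Rx 3), 𝔮'.IsPrime ∧ 𝔮'.IsHomogeneous (homogeneousSubmodule (Fin (3 + 1)) ℚ) ∧
      IsUnmixedOfRank 𝔮' 2 ∧ 𝔮' ∈ (Ideal.span {Q} ⊔ Ideal.span {P}).minimalPrimes ∧
      Ideal.span {Q} ⊔ Ideal.span {P} ⊔ Ideal.span {T} ≤ 𝔮' ∧ 𝔮' < 𝔭 := by
  intro Q P T a b τ hQ0 hQ hP hT ha hb _hτ hprime hPQ 𝔭 h𝔭 _hhom hunm hle
  set J : Ideal (Rx 3) := Ideal.span {Q} ⊔ Ideal.span {P} ⊔ Ideal.span {T} with hJ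
  set J₂ : Ideal (Rx 3) := Ideal.span {Q} ⊔ Ideal.span {P} with hJ₂
  obtain ⟨𝔮', h𝔮'min, h𝔮'le⟩ := Ideal.exists_minimalPrimes_le hle
  by_cases heq : 𝔮' = 𝔭
  · exact Or.inl (heq ▸ h𝔮'min)
  · right
    have hlt : 𝔮' < 𝔭 := lt_of_le_of_ne h𝔮'le heq
    haveI h𝔮'prime : 𝔮'.IsPrime := h𝔮'min.1.1
    haveI := h𝔭
    -- homogeneity of `J` and of its minimal prime `𝔮'`
    have hJhom : J.IsHomogeneous (homogeneousSubmodule (Fin (3 + 1)) ℚ) :=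
      ((SpaceCI.isHomogeneous_span hQ).sup (SpaceCI.isHomogeneous_span hP)).sup
        (SpaceCI.isHomogeneous_span hT)
    have h𝔮'hom : 𝔮'.IsHomogeneous (homogeneousSubmodule (Fin (3 + 1)) ℚ) :=
      Literature.RingTheory.MvPolynomial.isHomogeneous_of_mem_minimalPrimes hJhom h𝔮'min
    -- a minimal prime `𝔮₂ ≤ 𝔮'` of the c.i. `(Q, P)` has `dim = 2`
    have hJ₂le : J₂ ≤ 𝔮' := le_sup_left.trans h𝔮'min.1.2
    obtain ⟨𝔮₂, h𝔮₂min, h𝔮₂le⟩ := Ideal.exists_minimalPrimes_le hJ₂le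
    haveI h𝔮₂prime : 𝔮₂.IsPrime := h𝔮₂min.1.1
    have h𝔮₂ass : 𝔮₂ ∈ associatedPrimes (Rx 3) (Rx 3 ⧸ J₂) := by
      -- minimal primes are associated (the landed `CurveHilbert.mem_associatedPrimes_of_mem_minimalPrimes`,
      -- inlined: its module is not yet built on the farm)
      have h := Module.associatedPrimes.minimalPrimes_annihilator_subset_associatedPrimes
        (R := Rx 3) (M := Rx 3 ⧸ J₂)
      rw [Ideal.annihilator_quotient] at h
      exact h h𝔮₂min
    have hdim₂ : ringKrullDim (Rx 3 ⧸ 𝔮₂) = (2 : ℕ) :=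
      SpaceCI.ringKrullDim_quotient_eq_two hQ0 hQ hP ha hb hprime hPQ h𝔮₂ass
    -- `dim/𝔭 = 1`, so `2 ≤ dim/𝔮' ≤ dim/𝔮₂ = 2`
    have hdim𝔭 : ringKrullDim (Rx 3 ⧸ 𝔭) = (1 : ℕ) := rank_eq_one h𝔭 hunm
    have hlow : ((2 : ℕ) : WithBot ℕ∞) ≤ ringKrullDim (Rx 3 ⧸ 𝔮') := by
      have h := SatelliteDichotomy.ringKrullDim_quotient_add_one_le_of_lt hlt
      rw [hdim𝔭] at h
      exact le_trans (by exact_mod_cast le_rfl) h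
    have hup : ringKrullDim (Rx 3 ⧸ 𝔮') ≤ ((2 : ℕ) : WithBot ℕ∞) := by
      rw [← hdim₂]
      exact ringKrullDim_le_of_surjective (Ideal.Quotient.factor h𝔮₂le)
        (Ideal.Quotient.factor_surjective h𝔮₂le)
    have hdim' : ringKrullDim (Rx 3 ⧸ 𝔮') = (2 : ℕ) := le_antisymm hup hlow
    -- hence `𝔮₂ = 𝔮'`
    have heq₂ : 𝔮₂ = 𝔮' := by
      by_contra hne
      have hlt₂ : 𝔮₂ < 𝔮' := lt_of_le_of_ne h𝔮₂le hne
      have h := SatelliteDichotomy.ringKrullDim_quotient_add_one_le_of_lt hlt₂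
      rw [hdim', hdim₂] at h
      have h' : (2 : ℕ) + 1 ≤ 2 := by exact_mod_cast h
      omega
    refine ⟨𝔮', h𝔮'prime, h𝔮'hom, isUnmixedOfRank_of_isPrime h𝔮'prime hdim', heq₂ ▸ h𝔮₂min,
      h𝔮'min.1.2, hlt⟩

end Summit.Schanuel.Schanuel.Cruxes.ApproximationProperty.OrbitInterpolationDeterminant

end
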